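import Summits.HodgeConjecture.HodgeConjecture.Theorems.NikulinTwinTransportTwinTwistorTransportReduction
import Summits.HodgeConjecture.HodgeConjecture.Theorems.NikulinTwinTransportTwinTwistorTransportMukaiLiftDefs
import Summits.HodgeConjecture.HodgeConjecture.Theorems.NikulinTwinTransportTwinTwistorTransportLiftIffTwin
import Literature.AlgebraicGeometry.Surfaces.PolarisedK3TwinKuranishiFamily
import Literature.AlgebraicGeometry.Surfaces.K3HodgeTypesHolds

/-!
# Crux `NikulinTwinTransport.TwinTwistorTransport` (stmt-HodgeConjecture-14393), line
# `mukai-lift-full-similitude`: TIGHTNESS of the heart `LiftEngine` (reshape r3)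

Lead c3 (prover-line-stmt-HodgeConjecture-14393-c3-0), 2026-08-16. The heart of the line,
`LiftEngine` (skeleton `Cruxes/TwinTwistorTransport/Lines/mukai_lift_full_similitude.lean`, reshape r3:
per orientation family, and quantified over marked `M`-twin K3 pairs `(S, S′)` with Hilbert-type LINKED
marked `6`- and `4`-folds `(X, X′)` — the only pairs the composition `TwinTwistorTransport_of` ever feeds
it), says: if the Mukai lift `θ₀⁻¹M̃θ₀′` is algebraic at one anchor pair, it is algebraic at every linked
pair whose `X′`-period is chain-connected to the anchor's. This file proves the heart is NOT STRONGER
than the crux: it follows from twin transport for `M` (`TwinTransportFor[M]`, the lattice form of the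
crux) by the landed pointwise transfer `LiftIffTwin` (⇒), hence from `RatTwinTransportAt[2]`, hence —
by the landed `ratTwinTransport_of_twinTwistorTransport` (p85563) — from the route declaration
`TwinTwistorTransport` itself, modulo Buskin's theorem (`HodgeIsometryAlgebraic`, route item 13675),
composition of correspondences (`CompCorr`) and the summit support item `CupProductAlgebraic` (14350).
With the skeleton (crux ⇐ stubs) the heart is therefore CRUX-EQUIVALENT modulo the formal stubs and
those named inputs: the line carries exactly the crux's research content, no more.

Statements proved (all `--supports stmt-HodgeConjecture-14393`):
* `liftEngine_of_twinTransport` — `TwinTransportFor[M] → LiftEngineFor[M]` (anchor, deformation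
  classes and chain hypotheses are not even used: the transfer is pointwise);
* `liftEngine_of_ratTwinTransport` — `RatTwinTransportAt[2] → LiftEngine` (registered statement, verbatim);
* `liftEngine_of_twinTwistorTransport` — `TwinTwistorTransport → LiftEngine` modulo the named inputs.

References: [Markman2024] E. Markman, Rational Hodge isometries of hyper-Kähler varieties of K3^[n]
type are algebraic, Compos. Math. 160 (2024), Thm. 1.1/1.5 (the engine this heart transposes);
[Buskin2019] N. Buskin, J. reine angew. Math. 755 (2019), §6.2, Lemma 6.3; [Fulton1998] §16.1.
-/

-- `Summit.HodgeConjecture.HodgeConjecture.…` (summit = problem) duplicates a namespace component by design (D-0017).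
set_option linter.dupNamespace false

noncomputable section

namespace Summit.HodgeConjecture.HodgeConjecture.Theorems.TwinTwistorTransport.MukaiLift

open CategoryTheory MonoidalCategory
open scoped Manifold BigOperators
open Literature.AlgebraicGeometry.Motives Literature.AlgebraicGeometry.HodgeTheory
open Literature.AlgebraicGeometry.Surfaces Literature.AlgebraicGeometry.Hyperkaehler
open Literature.AlgebraicTopology.SingularHomology
open Literature.Geometry.Kaehler
open Summit.HodgeConjecture.HodgeConjecture.Theses.NikulinTwinTransport
open Summit.HodgeConjecture.HodgeConjecture.Theorems.NikulinTwinTransport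

/-! ### Local notations — verbatim those of `Theorems/NikulinTwinTransportTwinTwistorTransportReduction.lean` -/

/-- `MarkedK3[S, η, p, x]`: a marked K3 surface with period `x` (definitionally `IsMarkedK3 S η p x`). Local notation only. -/
local notation3 (prettyPrint := false) "MarkedK3[" S ", " η ", " p ", " x "]" =>
  (IsIntegralClass p ∧
    (∀ q : complexBetti S (2 * 2), IsIntegralClass q → ∃ n : ℤ, q = n • p) ∧
    (∀ c : complexBetti S (2 * 1), IsIntegralClass c ↔ ∃ v : K3Index → ℤ, η c = fun i => (v i : ℂ)) ∧
    (∀ a b : complexBetti S (2 * 1),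
        cupProduct (rfl : 2 * 1 + 2 * 1 = 2 * 2) a b = k3Form (η a) (η b) • p) ∧
    IsOfHodgeType 2 S (2 * 1) 2 0 (LinearEquiv.symm η x) ∧
    (∀ τ : complexBetti S (2 * 1), IsOfHodgeType 2 S (2 * 1) 2 0 τ → ∃ t : ℂ, τ = t • LinearEquiv.symm η x))

/-- `PeriodPt[x]`: a projective period point (definitionally `PeriodPt x`). Local notation only. -/
local notation3 (prettyPrint := false) "PeriodPt[" x "]" =>
  (k3Form x x = 0 ∧ 0 < (k3Form (star x) x).re ∧
    ∃ u : K3Index → ℤ, k3Form (fun i => (u i : ℂ)) x = 0 ∧ 0 < ∑ i, ∑ j, u i * k3Gram i j * u j)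

/-- `Corr[μ, S, S', hS, hS' ; γ, y] = [γ]_* y`. Local notation only. -/
local notation3 (prettyPrint := false) "Corr[" μ ", " S ", " S' ", " hS ", " hS' " ; " γ ", " y "]" =>
  complexGysin μ
    (IsSmoothProjective.tensor_holds (IsK3Surface.isSmoothProjective hS)
      (IsK3Surface.isSmoothProjective hS'))
    (IsK3Surface.isSmoothProjective hS) (SemiCartesianMonoidalCategory.fst S S')
    (rfl : 2 * 1 + 2 * 2 + 2 * 2 = 2 * 1 + 2 * (2 + 2))
    (cupProduct (rfl : 2 * 1 + 2 * 2 = 2 * 1 + 2 * 2)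
      (complexBetti.map (SemiCartesianMonoidalCategory.snd S S') (2 * 1) y) γ)

/-- `TwinTransportFor[M]`: the twin transport for the endomorphism `M` of `Λ_ℂ`. Local notation only. -/
local notation3 (prettyPrint := false) "TwinTransportFor[" M "]" =>
  ∀ (μ : OrientationFamily), μ.HasPoincareDuality →
    ∀ (S S' : SchemeOver ℂ) (hS : IsK3Surface S) (hS' : IsK3Surface S')
      (η : complexBetti S (2 * 1) ≃ₗ[ℂ] (K3Index → ℂ)) (p : complexBetti S (2 * 2))
      (x : K3Index → ℂ)
      (η' : complexBetti S' (2 * 1) ≃ₗ[ℂ] (K3Index → ℂ)) (p' : complexBetti S' (2 * 2))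
      (x' : K3Index → ℂ),
      MarkedK3[S, η, p, x] → PeriodPt[x] → MarkedK3[S', η', p', x'] → PeriodPt[x'] →
      (∃ t : ℂ, M x' = t • x) →
      ∃ γ ∈ algebraicClasses (MonoidalCategoryStruct.tensorObj S S') 2,
        ∀ y : complexBetti S' (2 * 1), η.symm (M (η' y)) = Corr[μ, S, S', hS, hS' ; γ, y]

/-- `RatTwinTransportAt[c]`: twin transport for EVERY rational `c`-similitude `M` of `(Λ_ℂ, k3Form)` with rational
two-sided inverse. Local notation only. -/
local notation3 (prettyPrint := false) "RatTwinTransportAt[" c "]" =>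
  ∀ (M N : Module.End ℂ (K3Index → ℂ)),
    (∀ v : K3Index → ℤ, ∃ w : K3Index → ℚ, M (fun i => (v i : ℂ)) = fun i => (w i : ℂ)) →
    (∀ v : K3Index → ℤ, ∃ w : K3Index → ℚ, N (fun i => (v i : ℂ)) = fun i => (w i : ℂ)) →
    M * N = 1 → N * M = 1 → (∀ a b, k3Form (M a) (M b) = c * k3Form a b) → TwinTransportFor[M]

/-- `CompCorr`: composition of algebraic correspondences between smooth projective surfaces (verbatim the hypothesis
`hC` of `ratTwinTransport_of_twinTwistorTransport`). Local notation only. -/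
local notation3 (prettyPrint := false) "CompCorr" =>
  ∀ (μ : OrientationFamily), μ.HasPoincareDuality →
    ∀ (A B C : SchemeOver ℂ) (hA : IsSmoothProjective 2 A) (hB : IsSmoothProjective 2 B)
      (hC : IsSmoothProjective 2 C),
      ∀ γ ∈ algebraicClasses (MonoidalCategoryStruct.tensorObj A B) 2,
        ∀ γ₁ ∈ algebraicClasses (MonoidalCategoryStruct.tensorObj B C) 2,
          ∃ γ₂ ∈ algebraicClasses (MonoidalCategoryStruct.tensorObj A C) 2,
            ∀ x : complexBetti C (2 * 1),
              complexGysin μ (IsSmoothProjective.tensor_holds hA hC) hA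
                  (SemiCartesianMonoidalCategory.fst A C)
                  (rfl : 2 * 1 + 2 * 2 + 2 * 2 = 2 * 1 + 2 * (2 + 2))
                  (cupProduct (rfl : 2 * 1 + 2 * 2 = 2 * 1 + 2 * 2)
                    (complexBetti.map (SemiCartesianMonoidalCategory.snd A C) (2 * 1) x) γ₂) =
                complexGysin μ (IsSmoothProjective.tensor_holds hA hB) hA
                  (SemiCartesianMonoidalCategory.fst A B)
                  (rfl : 2 * 1 + 2 * 2 + 2 * 2 = 2 * 1 + 2 * (2 + 2))
                  (cupProduct (rfl : 2 * 1 + 2 * 2 = 2 * 1 + 2 * 2)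
                    (complexBetti.map (SemiCartesianMonoidalCategory.snd A B) (2 * 1)
                      (complexGysin μ (IsSmoothProjective.tensor_holds hB hC) hB
                        (SemiCartesianMonoidalCategory.fst B C)
                        (rfl : 2 * 1 + 2 * 2 + 2 * 2 = 2 * 1 + 2 * (2 + 2))
                        (cupProduct (rfl : 2 * 1 + 2 * 2 = 2 * 1 + 2 * 2)
                          (complexBetti.map (SemiCartesianMonoidalCategory.snd B C) (2 * 1) x)
                          γ₁)))
                    γ)

/-- `LiftEngineFor[M]`: the heart `LiftEngine` of the line for ONE endomorphism `M` — verbatim the body of the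
registered stub after its binders `M N` and `IsTwoSimilitudePair M N` (reshape r3: per orientation family, over
marked `M`-twin K3 pairs with Hilbert-type linked marked `6`- and `4`-folds). Local notation only. -/
local notation3 (prettyPrint := false) "LiftEngineFor[" M "]" =>
  ∀ (μ : OrientationFamily), μ.HasPoincareDuality →
    ∀ (Xr Xr' : SchemeOver ℂ) (z₀' : LiftLat),
      (∃ (X₀ X₀' : SchemeOver ℂ) (θ₀ : complexBetti X₀ (2 * 1) ≃ₗ[ℂ] LiftLat)
          (θ₀' : complexBetti X₀' (2 * 1) ≃ₗ[ℂ] LiftLat) (pX₀ : complexBetti X₀ (2 * (2 * 3)))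
          (pX₀' : complexBetti X₀' (2 * (2 * 2))) (z₀ : LiftLat)
          (h₀ : MarkedHK 3 X₀ θ₀ pX₀ z₀) (h₀' : MarkedHK 2 X₀' θ₀' pX₀' z₀'),
          AreDeformationEquivalent (2 * 3) X₀ Xr ∧ AreDeformationEquivalent (2 * 2) X₀' Xr' ∧
            z₀ ∈ liftPeriodDomain 3 ∧ z₀' ∈ liftPeriodDomain 2 ∧
            (∃ t : ℂ, liftEnd M z₀' = t • z₀) ∧
              LiftAlg M μ X₀ X₀' h₀.1.1 h₀'.1.1 θ₀ θ₀') →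
      ∀ (S S' : SchemeOver ℂ) (hS : IsK3Surface S) (hS' : IsK3Surface S')
        (η : complexBetti S (2 * 1) ≃ₗ[ℂ] (K3Index → ℂ)) (p : complexBetti S (2 * 2)) (x : K3Index → ℂ)
        (η' : complexBetti S' (2 * 1) ≃ₗ[ℂ] (K3Index → ℂ)) (p' : complexBetti S' (2 * 2)) (x' : K3Index → ℂ),
        IsMarkedK3 S η p x → PeriodPt x → IsMarkedK3 S' η' p' x' → PeriodPt x' → (∃ t : ℂ, M x' = t • x) →
      ∀ (X X' : SchemeOver ℂ) (θ : complexBetti X (2 * 1) ≃ₗ[ℂ] LiftLat)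
        (θ' : complexBetti X' (2 * 1) ≃ₗ[ℂ] LiftLat) (pX : complexBetti X (2 * (2 * 3)))
        (pX' : complexBetti X' (2 * (2 * 2)))
        (h : MarkedHK 3 X θ pX (x, 0)) (h' : MarkedHK 2 X' θ' pX' (x', 0)),
        AreDeformationEquivalent (2 * 3) X Xr → AreDeformationEquivalent (2 * 2) X' Xr' →
        (∃ (ι : complexBetti (X ⊗ S) (2 * 2)) (ρ : complexBetti (S ⊗ X) (2 * (2 * 3))) (c : ℂ),
            IsHilbLink 3 μ S X (IsK3Surface.isSmoothProjective hS) h.1.1 η θ pX ι ρ c) →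
        (∃ (ι' : complexBetti (X' ⊗ S') (2 * 2)) (ρ' : complexBetti (S' ⊗ X') (2 * (2 * 2))) (c' : ℂ),
            IsHilbLink 2 μ S' X' (IsK3Surface.isSmoothProjective hS') h'.1.1 η' θ' pX' ι' ρ' c') →
        Relation.ReflTransGen (OnCommonGenericLiftLine 2) z₀' (x', 0) →
        LiftAlg M μ X X' h.1.1 h'.1.1 θ θ'

/-! ### The heart from twin transport -/

/-- **Tightness of the heart, pointwise.** Twin transport for `M` (`TwinTransportFor[M]`: the twin
similitude `η⁻¹ ∘ M ∘ η′` is algebraic on every marked projective `M`-twin pair) implies the heart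
`LiftEngineFor[M]` of the line, granted the summit support item `CupProductAlgebraic` (by name): at a
linked pair the twin is algebraic by hypothesis and the landed transfer `LiftIffTwin` (⇒) lifts it one
level up; the anchor, the deformation classes and the twistor chain are not used (the transfer is
pointwise).  So the heart asks for no more than the crux's lattice form. [cite: Buskin2019, §6.2 and Lemma 6.3] -/
theorem liftEngine_of_twinTransport : Theses.EndoscopicMiddleDegree.CupProductAlgebraic → ∀ (M : Module.End ℂ (K3Index → ℂ)), TwinTransportFor[M] → LiftEngineFor[M] := by
  intro hC M htw μ hμ Xr Xr' z₀' _ S S' hS hS' η p x η' p' x' hm hx hm' hx' hper X X' θ θ' pX pX' h h' _ _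
    hlink hlink' _
  obtain ⟨ι, ρ, c, hl⟩ := hlink
  obtain ⟨ι', ρ', c', hl'⟩ := hlink'
  have htwin : TwinAlg M μ S S' hS hS' η η' := htw μ hμ S S' hS hS' η p x η' p' x' hm hx hm' hx' hper
  exact (LiftIffTwin hC M μ hμ S S' hS hS' η η' X X' h.1.1 h'.1.1 θ θ' pX pX' ι ρ c ι' ρ' c' hl hl'
    (MarkedHK_pX_ne_zero μ h')).1 htwin

/-- **Tightness of the heart.** Twin transport at multiplier `2` for every rational lattice
`2`-similitude pair (`RatTwinTransportAt[2]`, crux-equivalent by the landed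
`twinTwistorTransport_iff_ratTwinTransport`) implies the registered heart `LiftEngine` of the line
(statement verbatim, reshape r3), granted `CupProductAlgebraic`. [cite: Buskin2019, §6.2 and Lemma 6.3] -/
theorem liftEngine_of_ratTwinTransport : Theses.EndoscopicMiddleDegree.CupProductAlgebraic → RatTwinTransportAt[(2 : ℂ)] → ∀ M N : Module.End ℂ (K3Index → ℂ), IsTwoSimilitudePair M N → LiftEngineFor[M] :=
  fun hC htw M N hMN => liftEngine_of_twinTransport hC M
    (htw M N hMN.1 hMN.2.1 hMN.2.2.1 hMN.2.2.2.1 hMN.2.2.2.2)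

/-- **The heart from the crux.** The route declaration `TwinTwistorTransport` implies the registered
heart `LiftEngine` of the line, modulo Buskin's theorem (`HodgeIsometryAlgebraic`, route item
stmt-HodgeConjecture-13675), composition of correspondences between smooth projective surfaces
(`CompCorr`), the summit support item `CupProductAlgebraic` (stmt-HodgeConjecture-14350) and the Hodge
types of `H²(K3)` (a theorem of the tree): by the landed converse reduction
`ratTwinTransport_of_twinTwistorTransport` (p85563) and `liftEngine_of_ratTwinTransport`.  Together with
the skeleton's `TwinTwistorTransport_of` the heart is crux-equivalent modulo the line's formal stubs and
these named inputs. [cite: Buskin2019, Thm. 1.1 and §6.2] -/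
theorem liftEngine_of_twinTwistorTransport : HodgeIsometryAlgebraic → CompCorr → Theses.EndoscopicMiddleDegree.CupProductAlgebraic → TwinTwistorTransport → ∀ M N : Module.End ℂ (K3Index → ℂ), IsTwoSimilitudePair M N → LiftEngineFor[M] :=
  fun hB hcomp hC h => liftEngine_of_ratTwinTransport hC
    (ratTwinTransport_of_twinTwistorTransport hB hcomp Huybrechts_K3_hodgeTypes_H2_holds h)

end Summit.HodgeConjecture.HodgeConjecture.Theorems.TwinTwistorTransport.MukaiLift

end
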